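import Summits.AtomisticToContinuum.Crystallization.Theorems.PerronTransitivityNoFractionalGainBarlowClass
import Summits.AtomisticToContinuum.Crystallization.Theorems.ReggeStarCoercivityDefectFreeCrystallizesSiteColumnLJ
import Summits.AtomisticToContinuum.Crystallization.Theorems.HullExactificationCascadeHcpLandscapeGapStubExactWindowEnergy

/-!
# Crux `PerronTransitivity.NoFractionalGain` (stmt-AtomisticToContinuum-15098), line `merge-perron`:
# K* holds on the whole Barlow class in the box — unconditionally

The TIGHTEST regime of the crux K* (`NoFractionalGain`: `2E*·∑cᵢ² ≤ ∑_{i≠j} cᵢcⱼV_LJ(dist xᵢ xⱼ)` for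
finite injective `x` and `c ≥ 0`, `E* = ⨅_Q e_LJ(Q)`) is the Barlow class: numerically the weighted Perron
quotient of fcc / dhcp / 9R sits only `1.0·10⁻⁴ / 5·10⁻⁵ / 3.5·10⁻⁵` below the hcp value (route file,
§Cheapest falsifier).  Cycle 2 of the line proved the class CONDITIONALLY
(`noFractionalGain_on_barlow_subsets_of_hcpSiteDomination`, p164518): finite pieces of a `2^{-1/6}`-separated
periodic Barlow stacking none of whose sites is bound better than an hcp site at the same spacings satisfy
K* for ALL real weights.  This file DISCHARGES both hypotheses on the box
`47/50 ≤ a ≤ 1`, `39/50·a ≤ h ≤ 17/20·a` (the box of the certified registry domination, item 3063) from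
landed tree theorems, and removes the periodicity assumption on the stacking word:

* `hcpSiteDomination_on_box` — for every Hägg word `s` and layer `m`,
  `barlowSiteEnergy lennardJones a h alternatingHagg 0 ≤ barlowSiteEnergy lennardJones a h s m`: the landed
  Lennard-Jones site-energy column `PalmGoodLaw.SiteColumnLJ.stub_siteColumnLJ` (hcp level `hcpE a h` plus a
  non-negative deficit `½(J₃ − J₂)·#cubic sides`, `J₃ − J₂ > 0`; it rests on the PROVED registry facts
  `LayeredHull.stub_registry` and `PricedHcpWindowsLjRegistry.stub_ljRegistryDomination` and the word column
  of crux 14993) and `barlowSiteEnergy_alternating_eq_hcpE`;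
* `barlowStacking_separated_on_box` — two distinct points of `barlowStacking a h s` satisfy `dist⁶ ≥ 1/2`
  (`HcpLandscapeGapBirth.ExactWindowEnergy.le_dist_barlowPos_sq`: `dist² ≥ 4/5`, and `(4/5)³ ≥ 1/2`);
* `perronKepler_on_barlow_subsets_box`, `noFractionalGain_on_periodic_barlow_subsets_box` — hence, for
  every PERIODIC Hägg word, every injective finite family of points of the stacking and ALL real `c`:
  `2·e_LJ(hcp a h)·∑cᵢ² ≤ ∑_{i≠j} cᵢcⱼV_LJ(dist xᵢ xⱼ)` and the crux's inequality with `2E*`;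
* `exists_periodic_hagg_barlowPos_eq` — a Hägg word agrees, on the layers `|k| ≤ L`, with a `2L`-periodic
  Hägg word (periodise the window `[−L, L)`), positions included (`barlowPos` depends on `s` only through
  the labels `haggLabel s k`, a cumulative sum from layer `0`);
* `noFractionalGain_on_barlow_subsets_box` — so the same holds for EVERY Hägg word `s` (a finite family
  of points sees finitely many layers): **K* is true, for all real weights, on every finite subset of every
  Barlow stacking with spacings in the box.**

What this does NOT touch: weighted PERTURBATIONS of Barlow stackings (second-order Perron-vs-phonon
stability) and everything non-Barlow — the open content of the registered stub
`stub_separatedNoFractionalGain`.  All `[folklore]` given the cited tree theorems.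
-/

noncomputable section

namespace Summit.AtomisticToContinuum.Crystallization.Theorems.PerronTransitivity.NoFractionalGain

open Literature.MathematicalPhysics.StatisticalMechanics
open Summit.AtomisticToContinuum.Crystallization.Theorems.PalmGoodLaw.SiteColumnLJ
  (stub_siteColumnLJ barlowSiteEnergy_alternating_eq_hcpE)
open Summit.AtomisticToContinuum.Crystallization.Theorems.HcpLandscapeGapBirth.ExactWindowEnergy
  (le_dist_barlowPos_sq)
open scoped BigOperators

section Box

variable {a h : ℝ} {s : ℤ → ℤ}

/-- **hcp-site domination on the box.**  For `47/50 ≤ a ≤ 1`, `39/50·a ≤ h ≤ 17/20·a`, every site of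
every Barlow stacking (any Hägg word `s`, any layer `m`) is bound no better than an hcp site at the same
spacings: `barlowSiteEnergy lennardJones a h alternatingHagg 0 ≤ barlowSiteEnergy lennardJones a h s m`.
From the landed site-energy column `stub_siteColumnLJ` (hcp level `hcpE a h` plus the non-negative deficit
`½(J₃ − J₂)·#cubic adjacent sides`) and `barlowSiteEnergy_alternating_eq_hcpE`. [folklore] -/
theorem hcpSiteDomination_on_box (ha : 47 / 50 ≤ a) (ha1 : a ≤ 1) (hh : 39 / 50 * a ≤ h)
    (hh1 : h ≤ 17 / 20 * a) (hs : IsHaggSeq s) (m : ℤ) :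
    barlowSiteEnergy lennardJones a h alternatingHagg 0 ≤ barlowSiteEnergy lennardJones a h s m := by
  obtain ⟨hgap, hcol⟩ := stub_siteColumnLJ a h ha ha1 hh hh1
  have h1 := hcol s hs m
  have ha0 : 0 < a := by linarith
  have hh0 : 0 < h := by linarith
  rw [barlowSiteEnergy_alternating_eq_hcpE ha0 hh0]
  have hι : (0 : ℝ) ≤ (if s (m + 1) = s m then 1 else 0) + (if s (m - 1) = s (m - 2) then 1 else 0) := by
    split_ifs <;> norm_num
  have hnn : 0 ≤ (1 / 2) * (barlowCoupling lennardJones a h 3 - barlowCoupling lennardJones a h 2) *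
      ((if s (m + 1) = s m then 1 else 0) + (if s (m - 1) = s (m - 2) then 1 else 0)) :=
    mul_nonneg (mul_nonneg (by norm_num) hgap.le) hι
  linarith

/-- **Separation on the box.**  For `47/50 ≤ a`, `39/50·a ≤ h` and a Hägg word `s`, two distinct points
of `barlowStacking a h s` satisfy `dist⁶ ≥ 1/2` (indeed `dist² ≥ 4/5`, `le_dist_barlowPos_sq`), so every
pair is attractive (`V_LJ ≤ 0` iff `dist⁶ ≥ 1/2`). [folklore] -/
theorem barlowStacking_separated_on_box (ha : 47 / 50 ≤ a) (hh : 39 / 50 * a ≤ h) (hs : IsHaggSeq s) :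
    ∀ y ∈ barlowStacking a h s, ∀ z ∈ barlowStacking a h s, y ≠ z → (1 : ℝ) / 2 ≤ dist y z ^ 6 := by
  rintro y ⟨k, i, j, rfl⟩ z ⟨k', i', j', rfl⟩ hne
  have hne' : (k, i, j) ≠ (k', i', j') := by
    intro h0
    apply hne
    simp only [Prod.mk.injEq] at h0
    obtain ⟨rfl, rfl, rfl⟩ := h0
    rfl
  have h45 : 4 / 5 ≤ dist (barlowPos a h s k i j) (barlowPos a h s k' i' j') ^ 2 :=
    le_dist_barlowPos_sq ha hh hs hne'
  have h3 : ((4 : ℝ) / 5) ^ 3 ≤ (dist (barlowPos a h s k i j) (barlowPos a h s k' i' j') ^ 2) ^ 3 :=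
    pow_le_pow_left₀ (by norm_num) h45 3
  calc (1 : ℝ) / 2 ≤ ((4 : ℝ) / 5) ^ 3 := by norm_num
    _ ≤ (dist (barlowPos a h s k i j) (barlowPos a h s k' i' j') ^ 2) ^ 3 := h3
    _ = dist (barlowPos a h s k i j) (barlowPos a h s k' i' j') ^ 6 := by ring

variable {p : ℕ}

/-- **The Perron–Kepler bound on the periodic Barlow class in the box (explicit hcp constant).**  For
`47/50 ≤ a ≤ 1`, `39/50·a ≤ h ≤ 17/20·a`, a periodic Hägg word `s`, every injective finite family `x` of
points of `barlowStacking a h s` and ALL real `c`: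
`2·e_LJ(hcp a h)·∑cᵢ² ≤ ∑_{i≠j} cᵢcⱼV_LJ(dist xᵢ xⱼ)` — the landed conditional theorem
`perronKepler_on_barlow_subsets_of_hcpSiteDomination` with both hypotheses discharged. [folklore] -/
theorem perronKepler_on_barlow_subsets_box (ha0 : 0 < a) (hh0 : 0 < h) (ha : 47 / 50 ≤ a) (ha1 : a ≤ 1)
    (hh : 39 / 50 * a ≤ h) (hh1 : h ≤ 17 / 20 * a) (hs : IsHaggSeq s) (hp : p ≠ 0)
    (hsp : ∀ i, s (i + p) = s i) {N : ℕ} (x : Fin N → EuclideanSpace ℝ (Fin 3))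
    (hx : Function.Injective x) (hmem : ∀ i, x i ∈ barlowStacking a h s) (c : Fin N → ℝ) :
    2 * (hcpPeriodicConfiguration ha0.ne' hh0.ne').energyPerParticle lennardJones * ∑ i, c i ^ 2 ≤
      ∑ i, ∑ j ∈ Finset.univ.erase i, c i * c j * lennardJones (dist (x i) (x j)) :=
  perronKepler_on_barlow_subsets_of_hcpSiteDomination ha0 hh0 hp hsp
    (barlowStacking_separated_on_box ha hh hs) (fun m => hcpSiteDomination_on_box ha ha1 hh hh1 hs m)
    x hx hmem c

/-- **K* on the periodic Barlow class in the box** (abstract level `E* ≤ e_LJ(hcp a h)`): for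
`47/50 ≤ a ≤ 1`, `39/50·a ≤ h ≤ 17/20·a`, a periodic Hägg word `s`, every injective finite family `x` of
points of `barlowStacking a h s` and ALL real `c`, `2E*·∑cᵢ² ≤ ∑_{i≠j} cᵢcⱼV_LJ(dist xᵢ xⱼ)`. [folklore] -/
theorem noFractionalGain_on_periodic_barlow_subsets_box (ha : 47 / 50 ≤ a) (ha1 : a ≤ 1)
    (hh : 39 / 50 * a ≤ h) (hh1 : h ≤ 17 / 20 * a) (hs : IsHaggSeq s) (hp : p ≠ 0)
    (hsp : ∀ i, s (i + p) = s i) {N : ℕ} (x : Fin N → EuclideanSpace ℝ (Fin 3))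
    (hx : Function.Injective x) (hmem : ∀ i, x i ∈ barlowStacking a h s) (c : Fin N → ℝ) :
    2 * (⨅ Q : PeriodicConfiguration 3, Q.energyPerParticle lennardJones) * ∑ i, c i ^ 2 ≤
      ∑ i, ∑ j ∈ Finset.univ.erase i, c i * c j * lennardJones (dist (x i) (x j)) := by
  have ha0 : 0 < a := by linarith
  have hh0 : 0 < h := by linarith
  exact noFractionalGain_on_barlow_subsets_of_hcpSiteDomination a h ha0 hh0 s p hp hsp
    (barlowStacking_separated_on_box ha hh hs) (fun m => hcpSiteDomination_on_box ha ha1 hh hh1 hs m)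
    N x hx hmem c

end Box

/-! ## Periodising a stacking word outside a window -/

section Periodise

variable {a h : ℝ} {s : ℤ → ℤ}

/-- **A Hägg word is, on any finite window of layers, a periodic Hägg word.**  For a Hägg word `s` and
`L ≥ 1` there is a `2L`-periodic Hägg word `s'` (the periodic extension of `s|[−L, L)`) whose Barlow
stacking has the SAME layers `k` for `|k| ≤ L`: `barlowPos a h s' k i j = barlowPos a h s k i j` (positions
depend on `s` only through the labels `haggLabel s k`, cumulative sums of `s` between layer `0` and layer
`k`). [folklore] -/
theorem exists_periodic_hagg_barlowPos_eq (hs : IsHaggSeq s) {L : ℕ} (hL : 1 ≤ L) :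
    ∃ (s' : ℤ → ℤ) (p : ℕ), p ≠ 0 ∧ IsHaggSeq s' ∧ (∀ i, s' (i + p) = s' i) ∧
      ∀ k : ℤ, |k| ≤ L → ∀ i j : ℤ, barlowPos a h s' k i j = barlowPos a h s k i j := by
  set P : ℕ := 2 * L with hPdef
  have hP0 : P ≠ 0 := by omega
  have hPpos : (0 : ℤ) < (P : ℤ) := by exact_mod_cast Nat.pos_of_ne_zero hP0
  -- the periodic extension of the window `[-L, L)`
  refine ⟨fun i => s ((i + L) % (P : ℤ) - L), P, hP0, fun i => hs _, fun i => ?_, ?_⟩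
  · -- periodicity
    have : (i + (P : ℤ) + (L : ℤ)) % (P : ℤ) = (i + (L : ℤ)) % (P : ℤ) := by
      rw [show i + (P : ℤ) + (L : ℤ) = i + (L : ℤ) + (P : ℤ) by ring, Int.add_emod_right]
    simp only [this]
  · -- agreement of positions on the layers `|k| ≤ L`
    have hagree : ∀ i : ℤ, -(L : ℤ) ≤ i → i < L → s ((i + L) % (P : ℤ) - L) = s i := by
      intro i h1 h2
      have h3 : (i + L) % (P : ℤ) = i + L := by
        refine Int.emod_eq_of_lt (by omega) ?_
        rw [hPdef]; push_cast; omega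
      rw [h3, add_sub_cancel_right]
    have hlabel : ∀ k : ℤ, |k| ≤ L →
        haggLabel (fun i => s ((i + L) % (P : ℤ) - L)) k = haggLabel s k := by
      intro k hk
      obtain ⟨n, rfl | rfl⟩ := Int.eq_nat_or_neg k
      · have hn : (n : ℤ) ≤ L := by
          have := le_abs_self (n : ℤ); omega
        rw [haggLabel_natCast, haggLabel_natCast, haggWindow, haggWindow]
        refine Finset.sum_congr rfl fun i hi => ?_
        have hi' : i < n := Finset.mem_range.1 hi
        exact hagree _ (by omega) (by omega)
      · have hn : (n : ℤ) ≤ L := by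
          have := neg_le_abs (-(n : ℤ)); rw [neg_neg] at this; omega
        rw [haggLabel_neg_natCast, haggLabel_neg_natCast, haggWindow, haggWindow]
        congr 1
        refine Finset.sum_congr rfl fun i hi => ?_
        have hi' : i < n := Finset.mem_range.1 hi
        exact hagree _ (by omega) (by omega)
    intro k hk i j
    simp only [barlowPos, hlabel k hk]

/-- **K* on the whole Barlow class in the box — every Hägg word.**  For `47/50 ≤ a ≤ 1`,
`39/50·a ≤ h ≤ 17/20·a`, EVERY Hägg word `s` (periodic or not), every injective finite family `x` of points
of `barlowStacking a h s` and ALL real `c`: `2E*·∑cᵢ² ≤ ∑_{i≠j} cᵢcⱼV_LJ(dist xᵢ xⱼ)`, `E* = ⨅_Q e_LJ(Q)` —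
the crux's inequality (for `c ≥ 0` a fortiori).  A finite family meets only the layers `|k| ≤ L` for
some `L`, on which `s` agrees with a periodic Hägg word (`exists_periodic_hagg_barlowPos_eq`), and the
periodic case is `noFractionalGain_on_periodic_barlow_subsets_box`. [folklore] -/
theorem noFractionalGain_on_barlow_subsets_box : ∀ (a h : ℝ), 47 / 50 ≤ a → a ≤ 1 →
    39 / 50 * a ≤ h → h ≤ 17 / 20 * a → ∀ s : ℤ → ℤ, IsHaggSeq s →
    ∀ (N : ℕ) (x : Fin N → EuclideanSpace ℝ (Fin 3)), Function.Injective x →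
      (∀ i, x i ∈ barlowStacking a h s) → ∀ c : Fin N → ℝ,
        2 * (⨅ Q : PeriodicConfiguration 3, Q.energyPerParticle lennardJones) * ∑ i, c i ^ 2 ≤
          ∑ i, ∑ j ∈ Finset.univ.erase i, c i * c j * lennardJones (dist (x i) (x j)) := by
  intro a h ha ha1 hh hh1 s hs N x hx hmem c
  choose k ii jj hk using fun i => (mem_barlowStacking_iff.1 (hmem i))
  -- a window of layers containing the family
  set L : ℕ := (Finset.univ.sup fun i => (k i).natAbs) + 1 with hLdef
  have hkL : ∀ i, |k i| ≤ L := by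
    intro i
    have h1 : (k i).natAbs ≤ Finset.univ.sup fun i => (k i).natAbs :=
      Finset.le_sup (f := fun i => (k i).natAbs) (Finset.mem_univ i)
    rw [← Int.natCast_natAbs, hLdef]
    exact_mod_cast Nat.le_succ_of_le h1
  obtain ⟨s', p, hp, hs', hsp, hpos⟩ :=
    exists_periodic_hagg_barlowPos_eq (a := a) (h := h) hs (L := L) (by omega)
  have hmem' : ∀ i, x i ∈ barlowStacking a h s' := fun i =>
    ⟨k i, ii i, jj i, by rw [hk i, hpos (k i) (hkL i)]⟩
  exact noFractionalGain_on_periodic_barlow_subsets_box ha ha1 hh hh1 hs' hp hsp x hx hmem' c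

end Periodise

end Summit.AtomisticToContinuum.Crystallization.Theorems.PerronTransitivity.NoFractionalGain

end
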